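/-
Copyright (c) 2026. All rights reserved.
Released under Apache 2.0 license as described in the file LICENSE.
Authors: abc-iut cell, prover seat abc-iut-w5-d064 (wave 5, gen 4).
-/
import Literature.IUT.LogVolume.UnitLogFibres
import Literature.IUT.LogVolume.UnitLogRamificationCriterion
import HarnessLib

/-!
# When is the `p`-adic logarithm of a unit a unit?  The torsion–power criterion (all `p`)

Proof-only companion (theorems, no definitions) of the cell's unit-logarithm files
(`LocalUnitLog.lean`, `LogSeriesEstimates.lean`, `UnitLogFibres.lean`, abc-iut-S1;
`UnitLogRamificationCriterion.lean`, abc-iut-w5-d017).  Setting: `K` a nontrivially normed field which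
is a normed `ℚ_p`-algebra, ultrametric and proper (= a finite extension of `ℚ_p` with its `p`-adic norm);
`log_p = unitLog : 𝒪_K^× → K` the `p`-adic logarithm, `R^μ` = the roots of unity (`IsTorsionUnit`).

The question «does `log_p(𝒪_K^×)` meet `𝒪_K^×`?» (equivalently: is the depth-`≥ 2` image of the
log-link iterates inhabited, the cell's (Ind3) census) is answered at ODD `p` by the ramification
criterion `p ∣ e(K/ℚ_p)` (`RamificationCriterion.exists_norm_unitLog_eq_one_iff_dvd`); at `p = 2` it is
NOT a function of `(e, f)` (abc-iut-S1, 2026-08-26: both answers occur at `(e, f) = (4, 1)`).  This file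
proves the criterion that IS uniform in `K`, for every `p`, reducing the question to a unit equation:

* `norm_unitLog_eq_norm_one_sub` — **isometry**: `‖log_p w‖ = ‖1 − w‖` whenever `‖1 − w‖ ≤ ρ` with
  contraction constant `ρ·p^{1/(p−1)} < 1` (from abc-iut-S1's `norm_logSeries_add_le`).
* `exists_norm_unitLog_eq_one_iff_exists_torsion_mul_pow` — **THE TORSION–POWER CRITERION (radius
  form)**: for `N ≥ 1` with `‖N‖·p^{1/(p−1)} < 1`,
  `(∃ u ∈ 𝒪_K^×, ‖log_p u‖ = 1) ⟺ (∃ ζ ∈ R^μ, v ∈ 𝒪_K^×, ‖1 − ζ·v^N‖ = ‖N‖)`.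
  `⟸`: `log_p(ζ v^N) = N·log_p v` and the isometry; `⟹`: the SURJECTIVITY of the logarithm onto the
  ball `‖z‖ ≤ ‖N‖` (abc-iut-S1's successive approximation `exists_logSeries_eq`, no exponential) applied
  to `z = N·log_p u`, then the fibre description `log_p w = log_p v ↔ w ∈ R^μ·v` (`unitLog_eq_iff`).
* `Dyadic.exists_norm_unitLog_eq_one_iff` — `p = 2`, `N = 4` (`‖4‖·2 = 1/2 < 1`): **`log₂(𝒪_K^×)` meets
  `𝒪_K^×` iff `R^μ·(𝒪_K^×)⁴` meets the sphere `‖1 − w‖ = ‖4‖ = 1/4`** — the exact criterion conjectured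
  in abc-iut-S1's remark (STATUS 2026-08-26T09:26:27Z), valid for every finite `K/ℚ₂`; set form
  `Dyadic.logUnits_inter_sphere_nonempty_iff`.
* `OddPrime.exists_norm_unitLog_eq_one_iff` — `p` odd, `N = p` (`p⁻¹·p^{1/(p−1)} < 1`): the same with
  `‖1 − ζ·v^p‖ = ‖p‖ = p⁻¹`; combined with the ramification criterion,
  `OddPrime.dvd_absRamificationIdx_iff_exists_torsion_mul_pow`: **`p ∣ e(K/ℚ_p) ⟺ ∃ ζ ∈ R^μ, v ∈ 𝒪^×,
  ‖1 − ζ·v^p‖ = p⁻¹`**.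

Classical local arithmetic (Koblitz, *p-adic Numbers, p-adic Analysis, and Zeta-Functions*, Ch. IV
§1–2; Neukirch, *Algebraic Number Theory*, Ch. II (5.5)).  Nothing here is disputed mathematics; no IUT
statement is asserted; nothing bears on [IUTchIII] Cor. 3.12.
-/

noncomputable section

open Metric Set
open IsUltrametricDist

namespace Literature.IUT.LogVolume

namespace TorsionPowerCriterion

section General

variable (p : ℕ) [hp : Fact p.Prime]
variable {K : Type*} [NontriviallyNormedField K] [instK : NormedAlgebra ℚ_[p] K] [IsUltrametricDist K]
  [ProperSpace K]

/-! ### §1. The isometry `‖log_p w‖ = ‖1 − w‖` on small balls -/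

/-- **Isometry of the logarithm near `1`**: if `‖1 − w‖ ≤ ρ` with `ρ·p^{1/(p−1)} < 1`, then
`‖log_p w‖ = ‖1 − w‖` (`‖L(w) + (1 − w)‖ ≤ θ·‖1 − w‖ < ‖1 − w‖` and the ultrametric equality case).
[cite: Koblitz1984, Ch. IV §1] -/
theorem norm_unitLog_eq_norm_one_sub {ρ : ℝ} (hθ : ρ * (p : ℝ) ^ (1 / ((p : ℝ) - 1)) < 1) {w : K}
    (hw : ‖1 - w‖ ≤ ρ) : ‖unitLog w‖ = ‖1 - w‖ := by
  have hρ1 : ρ < 1 := radius_lt_one p K hθ hw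
  have hwP : IsPrincipal w := hw.trans_lt hρ1
  rw [unitLog_of_isPrincipal p hwP]
  rcases eq_or_ne (1 - w) 0 with h0 | h0
  · have hw1 : w = 1 := (sub_eq_zero.mp h0).symm
    rw [hw1, logSeries_one, sub_self]
  have hpos : 0 < ‖1 - w‖ := norm_pos_iff.mpr h0
  have hlt : ‖logSeries w + (1 - w)‖ < ‖1 - w‖ := by
    calc ‖logSeries w + (1 - w)‖ ≤ ρ * (p : ℝ) ^ (1 / ((p : ℝ) - 1)) * ‖1 - w‖ :=
          norm_logSeries_add_le p K hθ.le hw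
      _ < 1 * ‖1 - w‖ := by gcongr
      _ = ‖1 - w‖ := one_mul _
  have hne : ‖logSeries w + (1 - w)‖ ≠ ‖-(1 - w)‖ := by rw [norm_neg]; exact hlt.ne
  calc ‖logSeries w‖ = ‖(logSeries w + (1 - w)) + (-(1 - w))‖ := by rw [add_neg_cancel_right]
    _ = max ‖logSeries w + (1 - w)‖ ‖-(1 - w)‖ := norm_add_eq_max_of_norm_ne_norm hne
    _ = ‖1 - w‖ := by rw [norm_neg, max_eq_right hlt.le]

omit [IsUltrametricDist K] [ProperSpace K] in
include instK in
/-- The norm of a positive natural number `N` in `K` is positive (`K` has characteristic `0`).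
[cite: Koblitz1984, Ch. IV §1] -/
theorem norm_natCast_pos {N : ℕ} (hN : 0 < N) : 0 < ‖(N : K)‖ := by
  rw [norm_natCast_eq_padicNorm p K N]
  exact norm_pos_iff.mpr (Nat.cast_ne_zero.mpr hN.ne')

/-! ### §2. The torsion–power criterion, radius form -/

/-- **`⟸` (witness half, every `p`, every `N ≥ 1` with `‖N‖·p^{1/(p−1)} < 1`)**: if `ζ ∈ R^μ`, `v ∈ 𝒪^×`
and `‖1 − ζ·v^N‖ = ‖N‖`, then `‖log_p v‖ = 1` — since `log_p(ζ v^N) = N·log_p v` has norm `‖1 − ζ v^N‖`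
by the isometry. [cite: Koblitz1984, Ch. IV §2] -/
theorem norm_unitLog_eq_one_of_torsion_mul_pow {N : ℕ} (hN : 0 < N)
    (hθ : ‖(N : K)‖ * (p : ℝ) ^ (1 / ((p : ℝ) - 1)) < 1) {ζ v : K} (hζ : IsTorsionUnit K ζ)
    (hv : ‖v‖ = 1) (hNv : ‖1 - ζ * v ^ N‖ = ‖(N : K)‖) : ‖unitLog v‖ = 1 := by
  have hζ1 : ‖ζ‖ = 1 := hζ.norm_eq_one
  obtain ⟨n, hn, h1⟩ := hζ
  have hvN : ‖v ^ N‖ = 1 := by rw [norm_pow, hv, one_pow]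
  have key : ‖unitLog (ζ * v ^ N)‖ = ‖(N : K)‖ := by
    rw [norm_unitLog_eq_norm_one_sub p hθ hNv.le, hNv]
  rw [unitLog_mul p hζ1 hvN, unitLog_eq_zero_of_pow_eq_one p hn h1, zero_add, unitLog_pow p hv,
    norm_mul, ← mul_one ‖(N : K)‖, mul_assoc, one_mul] at key
  exact mul_left_cancel₀ (norm_natCast_pos p hN).ne' key

/-- **`⟹` (surjectivity half)**: if some unit `u` has `‖log_p u‖ = 1`, then `z := N·log_p u` lies in the
ball `‖z‖ ≤ ‖N‖`, on which the logarithm is ONTO from `{‖1 − w‖ ≤ ‖N‖}` (`exists_logSeries_eq`); a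
preimage `w` has `log_p w = log_p(u^N)`, so `w = ζ·u^N` with `ζ ∈ R^μ` (`unitLog_eq_iff`), and
`‖1 − ζ·u^N‖ = ‖log_p w‖ = ‖N‖`. [cite: Koblitz1984, Ch. IV §2] -/
theorem exists_torsion_mul_pow_of_norm_unitLog_eq_one {N : ℕ}
    (hθ : ‖(N : K)‖ * (p : ℝ) ^ (1 / ((p : ℝ) - 1)) < 1) {u : K} (hu : ‖u‖ = 1)
    (hlog : ‖unitLog u‖ = 1) : ∃ ζ : K, IsTorsionUnit K ζ ∧ ‖1 - ζ * u ^ N‖ = ‖(N : K)‖ := by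
  have huN : ‖u ^ N‖ = 1 := by rw [norm_pow, hu, one_pow]
  have hz : ‖unitLog (u ^ N)‖ ≤ ‖(N : K)‖ := by
    rw [unitLog_pow p hu, norm_mul, hlog, mul_one]
  obtain ⟨w, hw, hwz⟩ := exists_logSeries_eq p K hθ hz
  have hρ1 : ‖(N : K)‖ < 1 := radius_lt_one p K hθ hw
  have hwP : IsPrincipal w := hw.trans_lt hρ1
  have hw1 : ‖w‖ = 1 := hwP.norm_eq_one
  have hlogw : unitLog w = unitLog (u ^ N) := by rw [unitLog_of_isPrincipal p hwP, hwz]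
  obtain ⟨ζ, hζ, hwζ⟩ := (unitLog_eq_iff p K hw1 huN).mp hlogw
  refine ⟨ζ, hζ, ?_⟩
  rw [← hwζ, ← norm_unitLog_eq_norm_one_sub p hθ hw, hlogw, unitLog_pow p hu, norm_mul, hlog, mul_one]

/-- **THE TORSION–POWER CRITERION (radius form, every `p`)**: for `N ≥ 1` with `‖N‖·p^{1/(p−1)} < 1`,
SOME unit of `𝒪_K` has a unit `p`-adic logarithm iff `R^μ·(𝒪_K^×)^N` meets the sphere
`‖1 − w‖ = ‖N‖`:  `(∃ u, ‖u‖ = 1 ∧ ‖log_p u‖ = 1) ⟺ (∃ ζ ∈ R^μ, ∃ v, ‖v‖ = 1 ∧ ‖1 − ζ·v^N‖ = ‖N‖)`.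
[cite: Koblitz1984, Ch. IV §2] -/
theorem exists_norm_unitLog_eq_one_iff_exists_torsion_mul_pow {N : ℕ} (hN : 0 < N)
    (hθ : ‖(N : K)‖ * (p : ℝ) ^ (1 / ((p : ℝ) - 1)) < 1) :
    (∃ u : K, ‖u‖ = 1 ∧ ‖unitLog u‖ = 1) ↔
      ∃ ζ v : K, IsTorsionUnit K ζ ∧ ‖v‖ = 1 ∧ ‖1 - ζ * v ^ N‖ = ‖(N : K)‖ := by
  constructor
  · rintro ⟨u, hu, hlog⟩
    obtain ⟨ζ, hζ, hNu⟩ := exists_torsion_mul_pow_of_norm_unitLog_eq_one p hθ hu hlog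
    exact ⟨ζ, u, hζ, hu, hNu⟩
  · rintro ⟨ζ, v, hζ, hv, hNv⟩
    exact ⟨v, hv, norm_unitLog_eq_one_of_torsion_mul_pow p hN hθ hζ hv hNv⟩

/-- Set form: `log_p(𝒪_K^×) ∩ {‖z‖ = 1} ≠ ∅ ⟺ R^μ·(𝒪_K^×)^N` meets the sphere `‖1 − w‖ = ‖N‖`
(`N ≥ 1`, `‖N‖·p^{1/(p−1)} < 1`). [cite: Koblitz1984, Ch. IV §2] -/
theorem logUnits_inter_sphere_nonempty_iff_exists_torsion_mul_pow {N : ℕ} (hN : 0 < N)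
    (hθ : ‖(N : K)‖ * (p : ℝ) ^ (1 / ((p : ℝ) - 1)) < 1) :
    (logUnits K ∩ sphere 0 1).Nonempty ↔
      ∃ ζ v : K, IsTorsionUnit K ζ ∧ ‖v‖ = 1 ∧ ‖1 - ζ * v ^ N‖ = ‖(N : K)‖ := by
  rw [← exists_norm_unitLog_eq_one_iff_exists_torsion_mul_pow p hN hθ]
  constructor
  · rintro ⟨z, ⟨u, hu, rfl⟩, hz⟩
    exact ⟨u, hu, mem_sphere_zero_iff_norm.mp hz⟩
  · rintro ⟨u, hu, hlog⟩
    exact ⟨unitLog u, unitLog_mem_logUnits hu, mem_sphere_zero_iff_norm.mpr hlog⟩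

/-- The witness half needs no torsion factor: `‖1 − v^N‖ = ‖N‖` for a unit `v` already forces
`‖log_p v‖ = 1` (`ζ = 1`). [cite: Koblitz1984, Ch. IV §2] -/
theorem norm_unitLog_eq_one_of_norm_one_sub_pow {N : ℕ} (hN : 0 < N)
    (hθ : ‖(N : K)‖ * (p : ℝ) ^ (1 / ((p : ℝ) - 1)) < 1) {v : K} (hv : ‖v‖ = 1)
    (hNv : ‖1 - v ^ N‖ = ‖(N : K)‖) : ‖unitLog v‖ = 1 :=
  norm_unitLog_eq_one_of_torsion_mul_pow p hN hθ (isTorsionUnit_one K) hv (by rwa [one_mul])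

end General

/-! ### §3. `p` odd: `N = p`, radius `‖p‖ = p⁻¹` -/

namespace OddPrime

variable (p : ℕ) [hp : Fact p.Prime]
variable {K : Type*} [NontriviallyNormedField K] [instK : NormedAlgebra ℚ_[p] K] [IsUltrametricDist K]
  [ProperSpace K]

omit [IsUltrametricDist K] [ProperSpace K] in
/-- For `p` odd the radius `‖p‖ = p⁻¹` is admissible: `p⁻¹·p^{1/(p−1)} = p^{1/(p−1) − 1} < 1`.
[cite: Koblitz1984, Ch. IV §1] -/
theorem norm_prime_mul_rpow_lt_one (hp2 : p ≠ 2) :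
    ‖((p : ℕ) : K)‖ * (p : ℝ) ^ (1 / ((p : ℝ) - 1)) < 1 := by
  have hprime : p.Prime := hp.out
  have h3 : 3 ≤ p := by
    rcases hprime.eq_two_or_odd' with h | h
    · exact absurd h hp2
    · have := hprime.two_le; omega
  have hp3 : (3 : ℝ) ≤ p := by exact_mod_cast h3
  have hp1 : (1 : ℝ) < p := by linarith
  have hp0 : (0 : ℝ) < p := by linarith
  rw [norm_prime p K, ← Real.rpow_neg_one, ← Real.rpow_add hp0]
  refine Real.rpow_lt_one_of_one_lt_of_neg hp1 ?_
  have : 1 / ((p : ℝ) - 1) ≤ 1 / 2 :=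
    one_div_le_one_div_of_le (by norm_num) (by linarith)
  linarith

/-- **`p` odd**: `(∃ u ∈ 𝒪_K^×, ‖log_p u‖ = 1) ⟺ (∃ ζ ∈ R^μ, v ∈ 𝒪_K^×, ‖1 − ζ·v^p‖ = ‖p‖ = p⁻¹)`.
[cite: Koblitz1984, Ch. IV §2] -/
theorem exists_norm_unitLog_eq_one_iff (hp2 : p ≠ 2) :
    (∃ u : K, ‖u‖ = 1 ∧ ‖unitLog u‖ = 1) ↔
      ∃ ζ v : K, IsTorsionUnit K ζ ∧ ‖v‖ = 1 ∧ ‖1 - ζ * v ^ p‖ = (p : ℝ)⁻¹ := by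
  rw [← norm_prime p K]
  exact exists_norm_unitLog_eq_one_iff_exists_torsion_mul_pow p hp.out.pos
    (norm_prime_mul_rpow_lt_one p hp2)

/-- **`p` odd, combined with the ramification criterion** (abc-iut-w5-d017's
`RamificationCriterion.exists_norm_unitLog_eq_one_iff_dvd`): `p ∣ e(K/ℚ_p)` iff the unit equation
`‖1 − ζ·v^p‖ = p⁻¹` has a solution with `ζ ∈ R^μ`, `v ∈ 𝒪_K^×`. [cite: NeukirchANT1999, Ch. II (5.5)] -/
theorem dvd_absRamificationIdx_iff_exists_torsion_mul_pow (hp2 : p ≠ 2) :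
    p ∣ absRamificationIdx p K ↔
      ∃ ζ v : K, IsTorsionUnit K ζ ∧ ‖v‖ = 1 ∧ ‖1 - ζ * v ^ p‖ = (p : ℝ)⁻¹ := by
  rw [← RamificationCriterion.exists_norm_unitLog_eq_one_iff_dvd p hp2,
    exists_norm_unitLog_eq_one_iff p hp2]

/-- In particular (`ζ = 1`): a unit `v` with `‖1 − v^p‖ = p⁻¹` forces `p ∣ e(K/ℚ_p)` (`p` odd).
[cite: NeukirchANT1999, Ch. II (5.5)] -/
theorem dvd_absRamificationIdx_of_norm_one_sub_pow (hp2 : p ≠ 2) {v : K} (hv : ‖v‖ = 1)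
    (hpv : ‖1 - v ^ p‖ = (p : ℝ)⁻¹) : p ∣ absRamificationIdx p K :=
  (dvd_absRamificationIdx_iff_exists_torsion_mul_pow p hp2).mpr
    ⟨1, v, isTorsionUnit_one K, hv, by rwa [one_mul]⟩

end OddPrime

/-! ### §4. `p = 2`: `N = 4`, radius `‖4‖ = 1/4` -/

namespace Dyadic

variable {K : Type*} [NontriviallyNormedField K] [instK : NormedAlgebra ℚ_[2] K] [IsUltrametricDist K]
  [ProperSpace K]

variable (K) in
omit [IsUltrametricDist K] [ProperSpace K] in
/-- `‖4‖ = 4⁻¹` in a normed `ℚ₂`-algebra. [cite: Koblitz1984, Ch. IV §1] -/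
theorem norm_four : ‖((4 : ℕ) : K)‖ = (4 : ℝ)⁻¹ := by
  rw [show ((4 : ℕ) : K) = ((2 : ℕ) : K) ^ 2 by norm_num, norm_pow, norm_prime 2 K]
  norm_num

variable (K) in
omit [IsUltrametricDist K] [ProperSpace K] in
/-- At `p = 2` the radius `‖4‖ = 1/4` is admissible: `‖4‖·2^{1/(2−1)} = 1/2 < 1` (whereas `‖2‖ = 1/2` is
not: the dyadic logarithm is an isometry only on `1 + 4𝒪_K`). [cite: Koblitz1984, Ch. IV §1] -/
theorem norm_four_mul_rpow_lt_one : ‖((4 : ℕ) : K)‖ * ((2 : ℕ) : ℝ) ^ (1 / (((2 : ℕ) : ℝ) - 1)) < 1 := by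
  rw [norm_four K]
  norm_num

/-- **`p = 2` — THE DYADIC CRITERION** (every finite `K/ℚ₂`): SOME unit of `𝒪_K` has a unit dyadic
logarithm iff `R^μ·(𝒪_K^×)⁴` meets the sphere `‖1 − w‖ = ‖4‖`:
`(∃ u, ‖u‖ = 1 ∧ ‖log₂ u‖ = 1) ⟺ (∃ ζ ∈ R^μ, ∃ v, ‖v‖ = 1 ∧ ‖1 − ζ·v⁴‖ = 4⁻¹)`.
[cite: Koblitz1984, Ch. IV §2] -/
theorem exists_norm_unitLog_eq_one_iff :
    (∃ u : K, ‖u‖ = 1 ∧ ‖unitLog u‖ = 1) ↔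
      ∃ ζ v : K, IsTorsionUnit K ζ ∧ ‖v‖ = 1 ∧ ‖1 - ζ * v ^ 4‖ = (4 : ℝ)⁻¹ := by
  rw [← norm_four K]
  exact exists_norm_unitLog_eq_one_iff_exists_torsion_mul_pow 2 (by norm_num)
    (norm_four_mul_rpow_lt_one K)

/-- Set form at `p = 2`: `log₂(𝒪_K^×)` meets the unit sphere iff `R^μ·(𝒪_K^×)⁴` meets `‖1 − w‖ = 1/4`.
[cite: Koblitz1984, Ch. IV §2] -/
theorem logUnits_inter_sphere_nonempty_iff :
    (logUnits K ∩ sphere 0 1).Nonempty ↔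
      ∃ ζ v : K, IsTorsionUnit K ζ ∧ ‖v‖ = 1 ∧ ‖1 - ζ * v ^ 4‖ = (4 : ℝ)⁻¹ := by
  rw [← norm_four K]
  exact logUnits_inter_sphere_nonempty_iff_exists_torsion_mul_pow 2 (by norm_num)
    (norm_four_mul_rpow_lt_one K)

/-- **Witness lemma at `p = 2`** (abc-iut-S1's form): `ζ ∈ R^μ`, `‖v‖ = 1`, `‖1 − ζ·v⁴‖ = 1/4 ⇒
‖log₂ v‖ = 1`. [cite: Koblitz1984, Ch. IV §2] -/
theorem norm_unitLog_eq_one_of_torsion_mul_pow_four {ζ v : K} (hζ : IsTorsionUnit K ζ) (hv : ‖v‖ = 1)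
    (h4 : ‖1 - ζ * v ^ 4‖ = (4 : ℝ)⁻¹) : ‖unitLog v‖ = 1 :=
  norm_unitLog_eq_one_of_torsion_mul_pow 2 (by norm_num) (norm_four_mul_rpow_lt_one K) hζ hv
    (by rw [h4, norm_four K])

/-- The emptiness direction, contrapositive form used by the census files: if NO `ζ ∈ R^μ`, `v ∈ 𝒪_K^×`
solve `‖1 − ζ·v⁴‖ = 1/4`, then `log₂(𝒪_K^×)` misses the unit sphere. [cite: Koblitz1984, Ch. IV §2] -/
theorem logUnits_inter_sphere_eq_empty_of_forall
    (h : ∀ ζ v : K, IsTorsionUnit K ζ → ‖v‖ = 1 → ‖1 - ζ * v ^ 4‖ ≠ (4 : ℝ)⁻¹) :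
    logUnits K ∩ sphere 0 1 = ∅ := by
  rw [← Set.not_nonempty_iff_eq_empty, logUnits_inter_sphere_nonempty_iff]
  rintro ⟨ζ, v, hζ, hv, h4⟩
  exact h ζ v hζ hv h4

end Dyadic

end TorsionPowerCriterion

end Literature.IUT.LogVolume

end
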